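import Mathlib
import Summits.Ventures.HodgeRepro.Tier4.Common.SettingOfData
import Summits.Ventures.HodgeRepro.Tier4.Common.KTypeSpace
import Summits.Ventures.HodgeRepro.Tier4.Line1.InnerCalculus
import Summits.Ventures.HodgeRepro.Tier4.Line4.RieszOnKType
import Summits.Ventures.HodgeRepro.Tier4.Line4.ThetaEquivariance

/-!
# Tier4/Line4/RieszOnSetting — the norm clause of the re-cut discharged on L1's `Setting`: a non-zero member of an
invariant subspace of `Setting.ofAdelicData …` has `∫_{D_G} ‖f‖² ≠ 0`, so W2′ needs no displayed norm clause there

Blind re-derivation cell `pub-hodge-repro`, Tier 4 «prove the step» (README §9–§10), seat t4-L4-p1 (gen 2).  Tree path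
`lean/Summits/Ventures/HodgeRepro/Tier4/Line4/RieszOnSetting.lean`.  Imports typer-2's `Common/SettingOfData`
(`Setting.ofAdelicData`, the sorry-free RTF setting of the defined objects from displayed cocompactness data),
t4-L1-p4's `Line1/InnerCalculus` (`RTF.Setting.eq_zero_of_inner_self_eq_zero`: a continuous invariant function with
`S.inner ψ ψ = 0` vanishes), `Line4/RieszOnKType` (`innerDG`, `IsRieszVectorOn`, W2′) and `Line4/ThetaEquivariance`
(`countable_rationalPoints`).

WHAT IS PROVED.  `inner_ofAdelicData_eq`: the setting's `inner` IS `innerDG μ DG` (definitionally);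
`integral_normSq_ne_zero_of_invariant` / `_of_mem`: for `f` continuous and `G(k)`-invariant (e.g. a member of an
`IsInvariantSubspace` of the setting) with `f ≠ 0`, `∫_{D_G} ‖f‖² ≠ 0` (L1's positivity on the relatively compact
fundamental domain of the Haar measure); `hasNonzeroToricPeriod_of_rieszOn_setting`: W2′ with the norm clause
DISCHARGED — a Riesz vector of `P_{χ′}` on `Vτ ≤ V`, `V` an invariant subspace of the setting, witnesses
`P_{χ′} ≠ 0` on `V`.  So on the re-cut wall typed over `Setting.ofAdelicData` (plan-4 v0.16) the clause
`(∫_{D_G} ‖f‖² : ℝ) ≠ 0` of `exists_spectrum_of_rungs'` is a theorem, not a hypothesis; and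
`exists_spectrum_of_rungsS` is the GLUE of the re-cut on typer-2's exact objects (`Common/KTypeSpace`: `IsAdmissibleS`,
`kTypeSpace`, `IsCompactOpenIn`, `finitePart`): from W3″ — an `IsAdmissibleS` subspace `V`, a compact open `K` of the
finite part with `kTypeSpace … K V` finite-dimensional, and a Riesz vector of `P_{χ′}` on that `K`-type space with
non-zero `T`-period against `χ` — conclude `IsAdmissibleS V ∧ P_{χ′} ≠ 0 on V ∧ ∃ f ∈ V, f ≠ 0 ∧ P_χ(f|_T) ≠ 0`.
`Vτ` is PINNED to `kTypeSpace … K V` (plan-4 S13216 (2), crit-2 S13222).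

HC_CM is NOT proved by anyone in this repository.
-/

set_option autoImplicit false

noncomputable section

namespace Summit.Ventures.HodgeRepro.Tier4.Line4

open Summit.Ventures.HodgeRepro.Tier4.Common Summit.Ventures.HodgeRepro.Tier4.Line1 MeasureTheory NumberField

variable {k : Type} [Field k] [NumberField k] (W : PlaneData k)
  [MeasurableSpace (GA W)] [BorelSpace (GA W)] (R : RTFData W) (μ : Measure (GA W))
  [μ.IsHaarMeasure] [R.μT.IsHaarMeasure] [R.μT'.IsHaarMeasure] (DG : Set (GA W))
  (fdG : IsFundamentalDomain (rationalPoints W) DG μ) (compG : IsCompact (closure DG))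
  (compT : IsCompact (closure R.DT)) (compT' : IsCompact (closure R.DT'))

/-- The setting's pairing is `innerDG μ DG`. -/
theorem inner_ofAdelicData_eq (φ ψ : GA W → ℂ) :
    (Setting.ofAdelicData W R μ DG fdG compG compT compT').inner φ ψ = innerDG μ DG φ ψ := rfl

/-- **A non-zero continuous `G(k)`-invariant function has non-zero norm on `D_G`** (L1's
`eq_zero_of_inner_self_eq_zero` on the setting of the defined objects). -/
theorem integral_normSq_ne_zero_of_invariant {f : GA W → ℂ}
    (hinv : (Setting.ofAdelicData W R μ DG fdG compG compT compT').Invariant f) (hc : Continuous f)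
    (hne : f ≠ 0) : (∫ x in DG, ‖f x‖ ^ 2 ∂μ : ℝ) ≠ 0 := by
  intro h0
  haveI : Countable (Setting.ofAdelicData W R μ DG fdG compG compT compT').Gk := countable_rationalPoints W
  apply hne
  apply (Setting.ofAdelicData W R μ DG fdG compG compT compT').eq_zero_of_inner_self_eq_zero hinv hc
  rw [inner_ofAdelicData_eq, innerDG_self_eq, h0]
  simp

/-- The same for a member of an invariant subspace of the setting (continuous and invariant by the structure). -/
theorem integral_normSq_ne_zero_of_mem {V : Submodule ℂ (GA W → ℂ)}
    (hV : (Setting.ofAdelicData W R μ DG fdG compG compT compT').IsInvariantSubspace (V : Set (GA W → ℂ)))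
    {f : GA W → ℂ} (hf : f ∈ V) (hne : f ≠ 0) : (∫ x in DG, ‖f x‖ ^ 2 ∂μ : ℝ) ≠ 0 :=
  integral_normSq_ne_zero_of_invariant W R μ DG fdG compG compT compT' (hV.inv f hf) (hV.cont f hf) hne

/-- **W2′ on the setting, the norm clause discharged**: a Riesz vector of `P_{χ′}` on `Vτ ≤ V`, `V` an invariant
subspace of the setting, witnesses `P_{χ′} ≠ 0` on `V`. -/
theorem hasNonzeroToricPeriod_of_rieszOn_setting {V Vτ : Submodule ℂ (GA W → ℂ)}
    (hV : (Setting.ofAdelicData W R μ DG fdG compG compT compT').IsInvariantSubspace (V : Set (GA W → ℂ)))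
    (hle : Vτ ≤ V) {f : GA W → ℂ} (hf : IsRieszVectorOn R μ DG Vτ f) :
    HasNonzeroToricPeriod W R.μT' R.DT' R.chi' V :=
  hasNonzeroToricPeriod_of_rieszOn R μ DG hle hf
    (integral_normSq_ne_zero_of_mem W R μ DG fdG compG compT compT' hV (hle hf.1) hf.2.1)

/-- **THE GLUE OF THE RE-CUT on the exact objects** (`Common/KTypeSpace`): W3″ ⟹ the `IsAdmissibleS` clause, `P_{χ′} ≠ 0`
on `V`, and a non-zero `f ∈ V` with non-zero `T`-period against `χ`; `Vτ := kTypeSpace … K V` is pinned, the norm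
clause is discharged on the setting. -/
theorem exists_spectrum_of_rungsS (q : QuadData k) (g g' : Matrix (Fin 4) (Fin 4) k) (w₀ : InfinitePlace k)
    (eP eM eP' eM' : InfinitePlace k → ℤ)
    (h3 : ∃ V : Submodule ℂ (GA W → ℂ),
      IsAdmissibleS W (Setting.ofAdelicData W R μ DG fdG compG compT compT') q g g' w₀ eP eM eP' eM' V ∧
      ∃ K : Subgroup (GA W), IsCompactOpenIn W (finitePart W) K ∧
        FiniteDimensional ℂ (kTypeSpace W q g g' eP eM eP' eM' K V) ∧
        ∃ f, IsRieszVectorOn R μ DG (kTypeSpace W q g g' eP eM eP' eM' K V) f ∧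
          periodLin W R.μT R.DT R.chi (restrictTo W (torusT W) f) ≠ 0) :
    ∃ V : Submodule ℂ (GA W → ℂ),
      IsAdmissibleS W (Setting.ofAdelicData W R μ DG fdG compG compT compT') q g g' w₀ eP eM eP' eM' V ∧
      HasNonzeroToricPeriod W R.μT' R.DT' R.chi' V ∧
      ∃ f ∈ V, f ≠ 0 ∧ periodLin W R.μT R.DT R.chi (restrictTo W (torusT W) f) ≠ 0 := by
  obtain ⟨V, hadm, K, _, _, f, hf, hmixed⟩ := h3
  have hle : kTypeSpace W q g g' eP eM eP' eM' K V ≤ V := kTypeSpace_le W q g g' eP eM eP' eM' K V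
  exact ⟨V, hadm, hasNonzeroToricPeriod_of_rieszOn_setting W R μ DG fdG compG compT compT' hadm.1 hle hf,
    f, hle hf.1, hf.2.1, hmixed⟩

end Summit.Ventures.HodgeRepro.Tier4.Line4

end
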